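import Mathlib
import Summits.NavierStokesRegularity.NavierStokesRegularity.Theorems.TypeIQuarterGateScarEnvelopeTypeISatelliteTowerEnergySaturation
import Summits.NavierStokesRegularity.NavierStokesRegularity.Theorems.TypeIQuarterGateScarEnvelopeTypeITopEpsilonRegularity

/-!
# Satellite tower for crux `ScarEnvelopeTypeI` (stmt-NavierStokesRegularity-23843) — Part V3–V4: the universal energy gap `ε_E` at scars; saturation along the census

Part V3–V4 of nsreg-p3's ROUND-41 artefact (section `EnergySaturation`): V3 `exists_energyGap` (tree E-form ε-regularity `…TopEpsilonRegularity`), `epsE`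
(a data def, `Classical.choose`), `epsE_pos`, `epsE_le_one`, `ABTower.epsE_le_local`, `ABTower.regPt_of_local_lt`, `RootObj.epsE_le_level`,
`epsE_le_minLevel`, `levelRates_eq_empty_of_lt_epsE`; V4 `DoublyMin.saturated_energy`, `TriplyMin.energy_local_eq`, `RigidDescent.saturated`,
`RigidRootDescent.saturated`, ★ `saturated_enemy_of_not_scarEnvelopeTypeI` (the saturated census of ¬23843).

PROVENANCE: declaration texts VERBATIM from the HOME artefact of the instrument seat nsreg-p3 g27 (cell `pub/ns-regularity-ideate`):
`round-41/Sat41.lean` (sha16 `1f5462a3478ca76f`, NEW part `partV.lean` 86a90bef12d2219d; a module written against the TREE;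
memo `round-41/ROUND-41.md`), scored PASS ★★ by referee ref3 g27 (`SCORE-p3-ROUND-41-0828.md` 2acea5ffdf77f685); the author cannot write under `Theorems/`
(`perm.theorems-prover-only`); landed by the prover ns-es-p1 g5 as landing hand of record (director-ns DIRECTOR-NS #237 (3)), split into
≤ 400-line modules, `E3` spelled out, the artefact's `#guard_msgs … #print axioms` certificates not landed.
`--supports stmt-NavierStokesRegularity-23843 --as helper`.

HONEST FRAMING: instrument theorems about HYPOTHETICAL Type-I zoom limits (Albritton–Barker objects of the census of crux
`TypeIQuarterGate.ScarEnvelopeTypeI`, item 23843); the analytic input is the tree's closure engine (compactness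
`local_typeI_compactness_twin_inBall`, sharpened to constant 1 in Part S1; Q1 whole-space), P1 rate inheritance, L8 persistence and the
tree's PROVED small-constant Liouville theorem; Parts R/S are order theory on the re-classing and closure lemmas.  NOTHING OPEN IS
PROVED: 23843, (L′) `TypeILiouvilleAB` / (L′₀), the GLOBAL (S∞) = `CritAttained`, (M𝐈₁), (E1⁺), (E2ᵣ), route ExtremalTypeIConstant's
cruxes, N0 and Navier–Stokes regularity are OPEN; `critRate`, `levelCrit I`, `liouvilleRate` are `sInf`s that are `0` by junk value
when the defining set is empty (every statement using them carries the nonemptiness hypothesis explicitly).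
-/

-- the summit-side namespace repeats a component by design (single-conjunct summit, D-0017)
set_option linter.dupNamespace false

open MeasureTheory Set Metric Filter Topology
open scoped ENNReal NNReal InnerProductSpace
open Literature.Analysis.FluidPDE

namespace Summit.NavierStokesRegularity.NavierStokesRegularity.Cruxes.ScarEnvelopeTypeI.ZoomDictionary

section EnergySaturation

variable {U : ℝ → (EuclideanSpace ℝ (Fin 3)) → (EuclideanSpace ℝ (Fin 3))} {P : ℝ → (EuclideanSpace ℝ (Fin 3)) → ℝ}

/-! ### V3. The energy gap at scars -/

/-- ★★ **V3. THE ENERGY GAP AT SCARS.**  There is a universal `ε_E ∈ (0, 1]` such that at every SCAR `y'`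
of every A–B object (any class) every backward parabolic neighbourhood carries Type-I energy
`𝐈(Q_ρ((0, y'))) ≥ ε_E`.  (Contrapositive of the tree's E-form ε-regularity at a top vertex
`SliceBudget.exists_bound_top_of_cknE_le` with `K = 1`: `A ≤ 𝐈 ≤ 1` and `E ≤ 𝐈 ≤ η₀(1)` on every `Q_ρ'((0, y'))`,
`ρ' ≤ ρ`, force essential boundedness near `(0, y')`.) -/
theorem exists_energyGap : ∃ εE : ℝ, 0 < εE ∧ εE ≤ 1 ∧
    ∀ (M : ℝ) (U : ℝ → (EuclideanSpace ℝ (Fin 3)) → (EuclideanSpace ℝ (Fin 3))) (P : ℝ → (EuclideanSpace ℝ (Fin 3)) → ℝ) (H : ℝ → (EuclideanSpace ℝ (Fin 3)) → (EuclideanSpace ℝ (Fin 3)) →L[ℝ] (EuclideanSpace ℝ (Fin 3))), ABTower M U P H →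
      ∀ y' : (EuclideanSpace ℝ (Fin 3)), ¬ RegPt U y' → ∀ ρ : ℝ, 0 < ρ →
        ENNReal.ofReal εE ≤ typeIBound (parabolicCylinder ρ (((0 : ℝ), y') : ℝ × (EuclideanSpace ℝ (Fin 3)))) U P H := by
  obtain ⟨η₀, hη₀, Hreg⟩ :=
    Summit.NavierStokesRegularity.NavierStokesRegularity.Cruxes.ScarEnvelopeTypeI.SliceBudget.exists_bound_top_of_cknE_le 1
  refine ⟨min η₀ 1, lt_min hη₀ one_pos, min_le_right _ _, fun M U P H hT y' hy ρ hρ => ?_⟩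
  by_contra hlt
  rw [not_le] at hlt
  obtain ⟨-, hIB, hH, -⟩ := hT
  obtain ⟨a, ha⟩ : ∃ a : ℝ, a = ‖y'‖ + ρ := ⟨_, rfl⟩
  have hapos : 0 < a := by rw [ha]; positivity
  obtain ⟨hsuit, -, -, hP⟩ := hIB a hapos
  have hQle : (parabolicCylinderOpens a (0 : ℝ × (EuclideanSpace ℝ (Fin 3))) : TopologicalSpace.Opens (ℝ × (EuclideanSpace ℝ (Fin 3)))) ≤
      slab (EuclideanSpace ℝ (Fin 3)) (Iio 0) isOpen_Iio := fun w hw => parabolicCylinder_zero_subset_lowerHalf a hw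
  have hH' := hH.mono hQle
  have hsub : parabolicCylinder ρ (((0 : ℝ), y') : ℝ × (EuclideanSpace ℝ (Fin 3))) ⊆ parabolicCylinder a (0 : ℝ × (EuclideanSpace ℝ (Fin 3))) :=
    parabolicCylinder_subset_zero (pow_le_pow_left₀ hρ.le (by rw [ha]; linarith [norm_nonneg y']) 2)
      (by rw [ha])
  -- `P ∈ L^{3/2}(Q_a(0))` gives `D(ρ; (0, y')) < ∞`
  have hDfin : cknD ρ (((0 : ℝ), y') : ℝ × (EuclideanSpace ℝ (Fin 3))) P ≠ ⊤ := by
    have hlt3 := hP.eLpNorm_lt_top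
    rw [eLpNorm_lt_top_iff_lintegral_rpow_enorm_lt_top (by norm_num)
      (ENNReal.div_ne_top (by norm_num) (by norm_num))] at hlt3
    have e : (3 / 2 : ℝ≥0∞).toReal = 3 / 2 := by rw [ENNReal.toReal_div]; norm_num
    rw [e] at hlt3
    have hfin : ∫⁻ w in parabolicCylinder a (0 : ℝ × (EuclideanSpace ℝ (Fin 3))), ‖P w.1 w.2‖ₑ ^ (3 / 2 : ℝ) ≠ ⊤ := hlt3.ne
    refine ENNReal.mul_ne_top (ENNReal.inv_ne_top.2 (pow_ne_zero _ (ENNReal.ofReal_pos.2 hρ).ne')) ?_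
    exact ne_top_of_le_ne_top hfin (lintegral_mono_set hsub)
  -- `A ≤ 𝐈(Q_ρ((0, y'))) < ε_E ≤ 1` and `E ≤ 𝐈(Q_ρ((0, y'))) < ε_E ≤ η₀` on every `Q_ρ'((0, y'))`, `ρ' ≤ ρ`
  have hsum : ∀ ρ' : ℝ, 0 < ρ' → ρ' ≤ ρ →
      abScaledSum ρ' (((0 : ℝ), y') : ℝ × (EuclideanSpace ℝ (Fin 3))) U P H ≤ ENNReal.ofReal (min η₀ 1) := fun ρ' hρ' hle =>
    (abScaledSum_le_typeIBound hρ' (Floor.cyl_mono hle hρ'.le _)).trans hlt.le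
  have hA : ∀ ρ' : ℝ, 0 < ρ' → ρ' ≤ ρ → cknAEss ρ' (((0 : ℝ), y') : ℝ × (EuclideanSpace ℝ (Fin 3))) U ≤ ((1 : ℝ≥0) : ℝ≥0∞) :=
    fun ρ' hρ' hle => ((cknAEss_le_abScaledSum' ρ' _ U P H).trans (hsum ρ' hρ' hle)).trans
      (by rw [ENNReal.coe_one]; exact ENNReal.ofReal_le_one.2 (min_le_right _ _))
  have hE : ∀ ρ' : ℝ, 0 < ρ' → ρ' ≤ ρ → cknE ρ' (((0 : ℝ), y') : ℝ × (EuclideanSpace ℝ (Fin 3))) H ≤ ENNReal.ofReal η₀ :=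
    fun ρ' hρ' hle => ((cknE_le_abScaledSum' ρ' _ U P H).trans (hsum ρ' hρ' hle)).trans
      (ENNReal.ofReal_le_ofReal (min_le_left _ _))
  obtain ⟨r, hr, C, hC⟩ := Hreg (parabolicCylinderOpens a (0 : ℝ × (EuclideanSpace ℝ (Fin 3)))) U P H hsuit hH'
    (((0 : ℝ), y') : ℝ × (EuclideanSpace ℝ (Fin 3))) ρ hρ hsub hDfin hA hE
  exact hy ⟨r, hr, C, hC⟩

/-- The ENERGY GAP constant `ε_E ∈ (0, 1]` (chosen once from V3). -/
noncomputable def epsE : ℝ := Classical.choose exists_energyGap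

/-- `0 < ε_E`. -/
theorem epsE_pos : 0 < epsE := (Classical.choose_spec exists_energyGap).1

/-- `ε_E ≤ 1`. -/
theorem epsE_le_one : epsE ≤ 1 := (Classical.choose_spec exists_energyGap).2.1

/-- V3a. At a scar of an A–B object every backward parabolic neighbourhood has energy `≥ ε_E`. -/
theorem ABTower.epsE_le_local {M : ℝ} {H : ℝ → (EuclideanSpace ℝ (Fin 3)) → (EuclideanSpace ℝ (Fin 3)) →L[ℝ] (EuclideanSpace ℝ (Fin 3))} (hT : ABTower M U P H) {y' : (EuclideanSpace ℝ (Fin 3))}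
    (hy : ¬ RegPt U y') {ρ : ℝ} (hρ : 0 < ρ) :
    ENNReal.ofReal epsE ≤ typeIBound (parabolicCylinder ρ (((0 : ℝ), y') : ℝ × (EuclideanSpace ℝ (Fin 3)))) U P H :=
  (Classical.choose_spec exists_energyGap).2.2 M U P H hT y' hy ρ hρ

/-- V3b (ε-regularity reading). A final-time point near which SOME backward parabolic neighbourhood has
Type-I energy `< ε_E` is regular. -/
theorem ABTower.regPt_of_local_lt {M : ℝ} {H : ℝ → (EuclideanSpace ℝ (Fin 3)) → (EuclideanSpace ℝ (Fin 3)) →L[ℝ] (EuclideanSpace ℝ (Fin 3))} (hT : ABTower M U P H) {y' : (EuclideanSpace ℝ (Fin 3))}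
    {ρ : ℝ} (hρ : 0 < ρ)
    (h : typeIBound (parabolicCylinder ρ (((0 : ℝ), y') : ℝ × (EuclideanSpace ℝ (Fin 3)))) U P H < ENNReal.ofReal epsE) :
    RegPt U y' := by
  by_contra hy
  exact absurd (hT.epsE_le_local hy hρ) (not_le.2 h)

/-- V3c. Every ROOT object (singular at its root) has energy `𝐈 ≥ ε_E`: the energy levels carrying a
root object start at `ε_E`, not at `0`. -/
theorem RootObj.epsE_le_level {M : ℝ} {n : TNode} (h : RootObj M n) : ENNReal.ofReal epsE ≤ n.level := by
  have h1 := h.1.epsE_le_local h.2 one_pos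
  exact h1.trans (typeIBound_mono (parabolicCylinder_subset_lowerHalf 1 (0 : (EuclideanSpace ℝ (Fin 3)))))

/-- V3d. The minimal level is at least the gap: `minLevel I ≥ ε_E` (for every `I`; by junk value `minLevel I = ⊤`
when the exactly-critical family is empty). -/
theorem epsE_le_minLevel (I : ℝ≥0∞) : ENNReal.ofReal epsE ≤ minLevel I :=
  le_sInf fun _ ⟨n, hn, hb⟩ => hb ▸ (show ExactCrit I n from hn).1.epsE_le_level

/-- V3e. A level below the gap carries no scar: if `I < ε_E` then `levelRates I = ∅`. -/
theorem levelRates_eq_empty_of_lt_epsE {I : ℝ≥0∞} (hI : I < ENNReal.ofReal epsE) : levelRates I = ∅ := by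
  rcases Set.eq_empty_or_nonempty (levelRates I) with h | hne
  · exact h
  · obtain ⟨n, hn⟩ := exactCrit_nonempty (lt_of_lt_of_le hI le_top) hne
    exact absurd ((epsE_le_minLevel I).trans ((minLevel_le hn).trans hn.2)) (not_le.2 hI)

/-! ### V4. Saturation along the census -/

/-- ★★ **V4a. DOUBLY-MINIMAL OBJECTS ARE ENERGY-SATURATED AND GAPPED.**  At every scar, every scale:
`ε_E ≤ minLevel I = 𝐈(Q_ρ((0, y'))) = 𝐈(n)`. -/
theorem DoublyMin.saturated_energy {I : ℝ≥0∞} {n : TNode} (h : DoublyMin I n) {y' : (EuclideanSpace ℝ (Fin 3))}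
    (hy : ¬ RegPt n.U y') {ρ : ℝ} (hρ : 0 < ρ) :
    ENNReal.ofReal epsE ≤ typeIBound (parabolicCylinder ρ (((0 : ℝ), y') : ℝ × (EuclideanSpace ℝ (Fin 3)))) n.U n.P n.H ∧
      typeIBound (parabolicCylinder ρ (((0 : ℝ), y') : ℝ × (EuclideanSpace ℝ (Fin 3)))) n.U n.P n.H = minLevel I ∧
      typeIBound (parabolicCylinder ρ (((0 : ℝ), y') : ℝ × (EuclideanSpace ℝ (Fin 3)))) n.U n.P n.H = n.level :=
  ⟨h.1.1.1.epsE_le_local hy hρ, h.energy_local_eq hy hρ, h.energy_local_eq_level hy hρ⟩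

/-- V4b. TRIPLY-MINIMAL objects (U10: doubly minimal AND `A_*(I)`-enveloped) are energy-saturated at every
scar and carry all three saturated functionals. -/
theorem TriplyMin.energy_local_eq {I : ℝ≥0∞} {n : TNode} (h : TriplyMin I n) {y' : (EuclideanSpace ℝ (Fin 3))}
    (hy : ¬ RegPt n.U y') {ρ : ℝ} (hρ : 0 < ρ) :
    typeIBound (parabolicCylinder ρ (((0 : ℝ), y') : ℝ × (EuclideanSpace ℝ (Fin 3)))) n.U n.P n.H = minLevel I :=
  h.1.energy_local_eq hy hρ

/-- V4c. Along a RIGID DESCENT (T6) every node is energy-saturated at every scar, at every scale, with the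
common value `minLevel I`. -/
theorem RigidDescent.saturated {I : ℝ≥0∞} (h : RigidDescent I) :
    ∃ c : ℕ → TNode, ∀ k, DoublyMin I (c k) ∧ Descends (c k) (c (k + 1)) ∧
      ∀ y' : (EuclideanSpace ℝ (Fin 3)), ¬ RegPt (c k).U y' → ∀ ρ : ℝ, 0 < ρ →
        typeIBound (parabolicCylinder ρ (((0 : ℝ), y') : ℝ × (EuclideanSpace ℝ (Fin 3)))) (c k).U (c k).P (c k).H = minLevel I := by
  obtain ⟨c, hc⟩ := h
  exact ⟨c, fun k => ⟨(hc k).1, (hc k).2.2.1, fun y' hy ρ hρ => (hc k).1.energy_local_eq hy hρ⟩⟩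

/-- V4d. Along a RIGID ROOT DESCENT (U2) every node is energy-saturated at every scar, at every scale. -/
theorem RigidRootDescent.saturated {I : ℝ≥0∞} (h : RigidRootDescent I) :
    ∃ c : ℕ → TNode, ∀ k, DoublyMin I (c k) ∧ RootDescends (c k) (c (k + 1)) ∧
      ∀ y' : (EuclideanSpace ℝ (Fin 3)), ¬ RegPt (c k).U y' → ∀ ρ : ℝ, 0 < ρ →
        typeIBound (parabolicCylinder ρ (((0 : ℝ), y') : ℝ × (EuclideanSpace ℝ (Fin 3)))) (c k).U (c k).P (c k).H = minLevel I := by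
  obtain ⟨c, hc⟩ := h
  exact ⟨c, fun k => ⟨(hc k).1, (hc k).2.2, fun y' hy ρ hρ => (hc k).1.energy_local_eq hy hρ⟩⟩

/-- ★★ **V4e. THE SATURATED NORMAL FORM OF THE ENEMY.**  If 23843 fails, then at the finite energy level
`I₀` of the violator (`M_c(I₀) ∈ [ε_L, M]`, `ε_E ≤ minLevel I₀ ≤ I₀`) there is a DOUBLY-MINIMAL object `n` ALL
of whose scars `y'` carry, at EVERY scale `ρ > 0`: (i) the exact tight rate `M_c(I₀)` (T3b); (ii) the full,
gapped energy `ε_E ≤ 𝐈(Q_ρ((0, y'))) = minLevel I₀` (V2/V3); and `n` is either TAME at the root or has, on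
EVERY sphere `‖y‖ = κ⁻¹`, `κ > 1`, a satellite at which the root blow-up is again doubly minimal (U1/U5). -/
theorem saturated_enemy_of_not_scarEnvelopeTypeI
    (h : ¬ Summit.NavierStokesRegularity.NavierStokesRegularity.Theses.TypeIQuarterGate.ScarEnvelopeTypeI) :
    ∃ (M : ℝ) (I₀ : ℝ≥0∞), I₀ < ⊤ ∧ (levelRates I₀).Nonempty ∧ levelCrit I₀ ∈ Icc epsL M ∧
      ENNReal.ofReal epsE ≤ minLevel I₀ ∧ minLevel I₀ ≤ I₀ ∧
      ∃ n : TNode, DoublyMin I₀ n ∧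
        (∀ y' : (EuclideanSpace ℝ (Fin 3)), ¬ RegPt n.U y' → tightRate n.U y' = levelCrit I₀ ∧ ∀ ρ : ℝ, 0 < ρ →
          ENNReal.ofReal epsE ≤ typeIBound (parabolicCylinder ρ (((0 : ℝ), y') : ℝ × (EuclideanSpace ℝ (Fin 3)))) n.U n.P n.H ∧
          typeIBound (parabolicCylinder ρ (((0 : ℝ), y') : ℝ × (EuclideanSpace ℝ (Fin 3)))) n.U n.P n.H = minLevel I₀) ∧
        (TameRoot n ∨ ∀ κ : ℝ, 1 < κ → ∃ n' : TNode, DoublyMin I₀ n' ∧ n'.level = n.level ∧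
          RootBlowup n n' ∧ ‖n'.y‖ = κ⁻¹ ∧ n'.y ∈ satellites n'.U) := by
  obtain ⟨M, I₀, hI₀, hne, hIcc, -, -⟩ := exactCritical_of_not_scarEnvelopeTypeI h
  obtain ⟨n, hn⟩ := doublyMin_nonempty hI₀ hne
  refine ⟨M, I₀, hI₀, hne, hIcc, epsE_le_minLevel I₀, minLevel_le_self hI₀ hne, n, hn,
    fun y' hy => ⟨hn.1.tightRate_eq hy, fun ρ hρ =>
      ⟨hn.1.1.1.epsE_le_local hy hρ, hn.energy_local_eq hy hρ⟩⟩, ?_⟩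
  by_cases hb : TameRoot n
  · exact Or.inl hb
  · refine Or.inr fun κ hκ => ?_
    rcases hn.tame_or_sphere hκ with hb' | ⟨n', hD', hlev, hrb, hz, hsat⟩
    · exact absurd hb' hb
    · exact ⟨n', hD', hlev, hrb, hz, hsat⟩

end EnergySaturation

end Summit.NavierStokesRegularity.NavierStokesRegularity.Cruxes.ScarEnvelopeTypeI.ZoomDictionary
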